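import Literature.Geometry.Symplectic.SurfaceTubeModelForm
import Mathlib.Analysis.InnerProductSpace.Calculus
import HarnessLib

/-!
# The model moment map: `ι_X s_M = -½ d(K ‖nrm‖²)` on the tube of a symplectic surface

Topic `Literature/Geometry/Symplectic`; layer C4b of the construction of the symplectic tubular
neighbourhood with its `U(1)`-structure of a closed symplectic surface `b : S → N` in a
symplectic `4`-manifold (McLean, GAFA 2012, **Lemma 5.14** / proof of **Lemma 5.17**: the
`U(1)`-action rotating the fibres is Hamiltonian for the model form), for the fact seat of
`Literature.Geometry.Symplectic.mclean_divisorComplement_convex_four`.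

For the model symplectic form `s_M = (b ∘ π₁)^* s + dλ₀` (`SurfaceTubeModelForm.lean`), the
fundamental vector field `Xm` of the model circle action (`SurfaceTubeCircleAction.lean`) and the
squared radius `ρ2 = K (π₁) ‖nrm‖²` (`SurfaceRoundTube.lean`) we prove the **moment map identity**

  `s_M (Xm x, v) = -½ d(ρ2)ₓ v`   (`Setup.sM_Xm`, `x ∈ N₃`),

i.e. the action is Hamiltonian for `s_M` with moment map `-½ ρ2`.  Ingredients: a chart bridge
`HasMFDerivAt ↔ HasFDerivAt ∘ chart⁻¹` for vector-valued maps on `N` (`hasMFDerivAt_iff_chart`),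
the product rules for `ρ2 = K ‖nrm‖²` and `Ω = K J` along the tube, and the two operator
identities `Q ((dQ v) n) = 0`, `⟪(dJ v) n, J n⟫ = 0` for `n` in the normal plane (from `Q² = Q`
and `‖J n‖ = ‖Q n‖`).

Everything here is proved; no named facts (D-0026).

## References

* M. McLean, *The growth rate of symplectic homology and affine varieties*, GAFA 22 (2012),
  Lemma 5.14 and proof of Lemma 5.17, pp. 35–37 (arXiv:1011.2542). [Mclean2012]
* D. McDuff, D. Salamon, *Introduction to Symplectic Topology*, 3rd ed. (2017), Thm. 3.4.10,
  §5.1 (Hamiltonian circle actions). [McDuffSalamon2017]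
-/

noncomputable section

open scoped Manifold ContDiff Topology RealInnerProductSpace
open Set Function Module Filter Metric
open Literature.Topology.FourManifolds
open Literature.Geometry.Kaehler
open Literature.Geometry.Manifold

namespace Literature.Geometry.Symplectic

namespace SurfaceTube

/-! ### The chart bridge for vector-valued maps on `N` -/

section ChartBridge

variable {N : Type*} [TopologicalSpace N] [ChartedSpace (EuclideanSpace ℝ (Fin 4)) N]
  {F' : Type*} [NormedAddCommGroup F'] [NormedSpace ℝ F']

/-- In the chart at `x` the written expression of a vector-valued map is `f ∘ chart⁻¹`.
[folklore] -/
theorem writtenInExtChartAt_vector (f : N → F') (x : N) :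
    writtenInExtChartAt (𝓡 4) 𝓘(ℝ, F') x f = f ∘ (extChartAt (𝓡 4) x).symm := by
  funext q
  simp only [writtenInExtChartAt, Function.comp_apply, extChartAt_model_space_eq_id,
    PartialEquiv.refl_coe, id_eq]

/-- **Chart bridge**: `HasMFDerivAt` of a vector-valued map on `N` at `x` is continuity at `x`
plus `HasFDerivAt` of `f ∘ chart⁻¹` at the chart image (the model `ℝ⁴` has no boundary).
[folklore] -/
theorem hasMFDerivAt_iff_chart {f : N → F'} {x : N}
    {L : EuclideanSpace ℝ (Fin 4) →L[ℝ] F'} :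
    HasMFDerivAt (𝓡 4) 𝓘(ℝ, F') f x L ↔
      ContinuousAt f x ∧ HasFDerivAt (E := EuclideanSpace ℝ (Fin 4))
        (f ∘ (extChartAt (𝓡 4) x).symm) L (extChartAt (𝓡 4) x x) := by
  constructor
  · rintro ⟨hc, hd⟩
    refine ⟨hc, ?_⟩
    rw [writtenInExtChartAt_vector, ModelWithCorners.Boundaryless.range_eq_univ,
      hasFDerivWithinAt_univ] at hd
    exact hd
  · rintro ⟨hc, hd⟩
    refine ⟨hc, ?_⟩
    rw [writtenInExtChartAt_vector, ModelWithCorners.Boundaryless.range_eq_univ,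
      hasFDerivWithinAt_univ]
    exact hd

/-- The chart expression of a differentiable vector-valued map has derivative `mfderiv`.
[folklore] -/
theorem hasFDerivAt_chart {f : N → F'} {x : N} (hf : MDifferentiableAt (𝓡 4) 𝓘(ℝ, F') f x) :
    HasFDerivAt (E := EuclideanSpace ℝ (Fin 4)) (f ∘ (extChartAt (𝓡 4) x).symm)
      (mfderiv (𝓡 4) 𝓘(ℝ, F') f x) (extChartAt (𝓡 4) x x) :=
  (hasMFDerivAt_iff_chart.1 hf.hasMFDerivAt).2

/-- Reading off `mfderiv` from a derivative of the chart expression. [folklore] -/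
theorem mfderiv_eq_of_hasFDerivAt_chart {f : N → F'} {x : N} {L : EuclideanSpace ℝ (Fin 4) →L[ℝ] F'}
    (hc : ContinuousAt f x)
    (hd : HasFDerivAt (E := EuclideanSpace ℝ (Fin 4)) (f ∘ (extChartAt (𝓡 4) x).symm) L
      (extChartAt (𝓡 4) x x)) :
    mfderiv (𝓡 4) 𝓘(ℝ, F') f x = L :=
  (hasMFDerivAt_iff_chart.2 ⟨hc, hd⟩).mfderiv

end ChartBridge

variable {N : Type*} [TopologicalSpace N] [ChartedSpace (EuclideanSpace ℝ (Fin 4)) N]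
  [IsManifold (𝓡 4) ∞ N] {S : Type*} [TopologicalSpace S] [ChartedSpace (EuclideanSpace ℝ (Fin 2)) S]
  [IsManifold (𝓡 2) ∞ S] {V : Type*} [NormedAddCommGroup V] [InnerProductSpace ℝ V]
  [FiniteDimensional ℝ V] (D : Setup N S V)

namespace Setup

variable [CompactSpace S] [Nonempty S]

/-! ### `K`, `J`, `Q` along the tube and their differentials -/

/-- `K` along the tube. [folklore] -/
def KN (x : N) : ℝ := D.K (D.π₁ x)

/-- `J` along the tube. [folklore] -/
def JN (x : N) : V →L[ℝ] V := D.J (D.π₁ x)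

/-- `Q` along the tube. [folklore] -/
def QN (x : N) : V →L[ℝ] V := D.Q (D.π₁ x)

/-- The differential of `KN`. [folklore] -/
def dK (x : N) : TangentSpace (𝓡 4) x →L[ℝ] ℝ := mfderiv (𝓡 4) 𝓘(ℝ, ℝ) D.KN x

/-- The differential of `JN`. [folklore] -/
def dJ (x : N) : TangentSpace (𝓡 4) x →L[ℝ] (V →L[ℝ] V) := mfderiv (𝓡 4) 𝓘(ℝ, V →L[ℝ] V) D.JN x

/-- The differential of `QN`. [folklore] -/
def dQ (x : N) : TangentSpace (𝓡 4) x →L[ℝ] (V →L[ℝ] V) := mfderiv (𝓡 4) 𝓘(ℝ, V →L[ℝ] V) D.QN x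

/-- The differential of `ρ2`. [folklore] -/
def dρ2 (x : N) : TangentSpace (𝓡 4) x →L[ℝ] ℝ := mfderiv (𝓡 4) 𝓘(ℝ, ℝ) D.ρ2 x

/-- `ρ2` is differentiable at the points of `N₁`. [folklore] -/
theorem mdifferentiableAt_ρ2 {x : N} (hx : x ∈ D.N₁) : MDifferentiableAt (𝓡 4) 𝓘(ℝ, ℝ) D.ρ2 x :=
  ((D.contMDiffOn_ρ2 x hx).contMDiffAt (D.isOpen_N₁.mem_nhds hx)).mdifferentiableAt (by simp)

/-- `KN` is smooth at the points of `N₁`. [folklore] -/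
theorem contMDiffAt_KN {x : N} (hx : x ∈ D.N₁) : ContMDiffAt (𝓡 4) 𝓘(ℝ, ℝ) ∞ D.KN x :=
  (D.contMDiff_K _).comp x (D.contMDiffAt_π₁ hx)

/-- `JN` is smooth at the points of `N₁`. [folklore] -/
theorem contMDiffAt_JN {x : N} (hx : x ∈ D.N₁) : ContMDiffAt (𝓡 4) 𝓘(ℝ, V →L[ℝ] V) ∞ D.JN x :=
  (D.contMDiff_J _).comp x (D.contMDiffAt_π₁ hx)

/-- `QN` is smooth at the points of `N₁`. [folklore] -/
theorem contMDiffAt_QN {x : N} (hx : x ∈ D.N₁) : ContMDiffAt (𝓡 4) 𝓘(ℝ, V →L[ℝ] V) ∞ D.QN x :=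
  (D.contMDiff_Q _).comp x (D.contMDiffAt_π₁ hx)

/-- `KN` is differentiable at the points of `N₁`. [folklore] -/
theorem mdifferentiableAt_KN {x : N} (hx : x ∈ D.N₁) : MDifferentiableAt (𝓡 4) 𝓘(ℝ, ℝ) D.KN x :=
  (D.contMDiffAt_KN hx).mdifferentiableAt (by simp)

/-- `JN` is differentiable at the points of `N₁`. [folklore] -/
theorem mdifferentiableAt_JN {x : N} (hx : x ∈ D.N₁) :
    MDifferentiableAt (𝓡 4) 𝓘(ℝ, V →L[ℝ] V) D.JN x :=
  (D.contMDiffAt_JN hx).mdifferentiableAt (by simp)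

/-- `QN` is differentiable at the points of `N₁`. [folklore] -/
theorem mdifferentiableAt_QN {x : N} (hx : x ∈ D.N₁) :
    MDifferentiableAt (𝓡 4) 𝓘(ℝ, V →L[ℝ] V) D.QN x :=
  (D.contMDiffAt_QN hx).mdifferentiableAt (by simp)

/-- `OmN = KN • JN` (`Ω = K J`). [folklore] -/
theorem OmN_eq_smul : D.OmN = fun x ↦ D.KN x • D.JN x := by
  funext x; exact D.Om_eq (D.π₁ x)

/-- `ρ2 = KN * ‖nrm‖²`. [folklore] -/
theorem ρ2_eq_mul : D.ρ2 = fun x ↦ D.KN x * ‖D.nrm x‖ ^ 2 := rfl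

/-- **Chain rule through the foot**: `dK v = dK_S (dπ₁ v)`, so `dK` kills `ker dπ₁`. [folklore] -/
theorem dK_eq_zero_of_dπ₁ {x : N} (hx : x ∈ D.N₁) {v : TangentSpace (𝓡 4) x} (hv : D.dπ₁ x v = 0) :
    D.dK x v = 0 := by
  have h := mfderiv_comp x ((D.contMDiff_K _).mdifferentiableAt (by simp)) (D.mdifferentiableAt_π₁ hx)
  have happ := congrArg (fun L : TangentSpace (𝓡 4) x →L[ℝ] TangentSpace 𝓘(ℝ, ℝ) (D.K (D.π₁ x)) ↦ L v) h
  rw [ContinuousLinearMap.comp_apply] at happ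
  show mfderiv (𝓡 4) 𝓘(ℝ, ℝ) (D.K ∘ D.π₁) x v = 0
  refine happ.trans ?_
  show mfderiv (𝓡 2) 𝓘(ℝ, ℝ) D.K (D.π₁ x) (D.dπ₁ x v) = 0
  rw [hv]
  exact map_zero _

/-- `dOm` kills `ker dπ₁`. [folklore] -/
theorem dOm_eq_zero_of_dπ₁ {x : N} (hx : x ∈ D.N₁) {v : TangentSpace (𝓡 4) x} (hv : D.dπ₁ x v = 0) :
    D.dOm x v = 0 := by
  have h := mfderiv_comp x ((D.contMDiff_Om _).mdifferentiableAt (by simp)) (D.mdifferentiableAt_π₁ hx)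
  have happ := congrArg
    (fun L : TangentSpace (𝓡 4) x →L[ℝ] TangentSpace 𝓘(ℝ, V →L[ℝ] V) (D.Om (D.π₁ x)) ↦ L v) h
  rw [ContinuousLinearMap.comp_apply] at happ
  show mfderiv (𝓡 4) 𝓘(ℝ, V →L[ℝ] V) (D.Om ∘ D.π₁) x v = 0
  refine happ.trans ?_
  show mfderiv (𝓡 2) 𝓘(ℝ, V →L[ℝ] V) D.Om (D.π₁ x) (D.dπ₁ x v) = 0
  rw [hv]
  exact map_zero _

/-- `d(b ∘ π₁)` kills `ker dπ₁`. [folklore] -/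
theorem mfderiv_bπ₁_eq_zero_of_dπ₁ {x : N} (hx : x ∈ D.N₁) {v : TangentSpace (𝓡 4) x}
    (hv : D.dπ₁ x v = 0) : mfderiv (𝓡 4) (𝓡 4) (D.b ∘ D.π₁) x v = 0 := by
  rw [mfderiv_comp x (D.mdifferentiableAt_b _) (D.mdifferentiableAt_π₁ hx)]
  show mfderiv (𝓡 2) (𝓡 4) D.b (D.π₁ x) (D.dπ₁ x v) = 0
  rw [hv]
  exact map_zero _

/-! ### Product rules along the tube (through the chart bridge) -/

/-- **`d(ρ2) v = dK v ‖n‖² + K · 2 ⟪n, dn v⟫`** (`n = nrm x`, `dn = d(nrm)ₓ`). [folklore] -/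
theorem dρ2_apply {x : N} (hx : x ∈ D.N₁) (v : TangentSpace (𝓡 4) x) :
    D.dρ2 x v = D.dK x v * ‖D.nrm x‖ ^ 2 + D.KN x * (2 * ⟪D.nrm x, D.dnrm x v⟫) := by
  set φ := extChartAt (𝓡 4) x with hφ
  have hx0 : φ.symm (φ x) = x := extChartAt_to_inv x
  have hK : HasFDerivAt (E := EuclideanSpace ℝ (Fin 4)) (D.KN ∘ φ.symm) (D.dK x) (φ x) := hasFDerivAt_chart (D.mdifferentiableAt_KN hx)
  have hn : HasFDerivAt (E := EuclideanSpace ℝ (Fin 4)) (D.nrm ∘ φ.symm) (D.dnrm x) (φ x) := hasFDerivAt_chart (D.mdifferentiableAt_nrm hx)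
  have hprod := hK.mul hn.norm_sq
  have hfun : ((D.KN ∘ φ.symm) * fun q ↦ ‖(D.nrm ∘ φ.symm) q‖ ^ 2) = D.ρ2 ∘ φ.symm := by
    funext q; rfl
  rw [hfun] at hprod
  have huniq := mfderiv_eq_of_hasFDerivAt_chart (D.continuousAt_ρ2 hx) hprod
  have happ := congrArg (fun T : EuclideanSpace ℝ (Fin 4) →L[ℝ] ℝ ↦ T v) huniq
  simp only [Function.comp_apply, hx0, add_apply, smul_apply, ContinuousLinearMap.comp_apply,
    innerSL_apply_apply, smul_eq_mul, nsmul_eq_mul, Nat.cast_ofNat] at happ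
  refine happ.trans ?_
  show D.KN x * (2 * ⟪D.nrm x, D.dnrm x v⟫) + ‖D.nrm x‖ ^ 2 * D.dK x v = _
  ring

/-- **`(dΩ v) = dK v • J + K • (dJ v)`** (`Ω = K J`). [folklore] -/
theorem dOm_apply {x : N} (hx : x ∈ D.N₁) (v : TangentSpace (𝓡 4) x) :
    D.dOm x v = D.dK x v • D.JN x + D.KN x • D.dJ x v := by
  set φ := extChartAt (𝓡 4) x with hφ
  have hx0 : φ.symm (φ x) = x := extChartAt_to_inv x
  have hK : HasFDerivAt (E := EuclideanSpace ℝ (Fin 4)) (D.KN ∘ φ.symm) (D.dK x) (φ x) := hasFDerivAt_chart (D.mdifferentiableAt_KN hx)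
  have hJ : HasFDerivAt (E := EuclideanSpace ℝ (Fin 4)) (D.JN ∘ φ.symm) (D.dJ x) (φ x) := hasFDerivAt_chart (D.mdifferentiableAt_JN hx)
  have hprod := hK.smul hJ
  have hfun : ((D.KN ∘ φ.symm) • (D.JN ∘ φ.symm)) = D.OmN ∘ φ.symm := by
    funext q
    show D.KN (φ.symm q) • D.JN (φ.symm q) = D.OmN (φ.symm q)
    exact (D.Om_eq (D.π₁ (φ.symm q))).symm
  rw [hfun] at hprod
  have huniq := mfderiv_eq_of_hasFDerivAt_chart (D.contMDiffAt_OmN hx).continuousAt hprod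
  have happ := congrArg (fun T : EuclideanSpace ℝ (Fin 4) →L[ℝ] (V →L[ℝ] V) ↦ T v) huniq
  simp only [Function.comp_apply, hx0, add_apply, smul_apply, ContinuousLinearMap.smulRight_apply] at happ
  exact happ.trans (add_comm _ _)

/-- **`Q ∘ (dQ v) + (dQ v) ∘ Q = dQ v`** (differentiate `Q² = Q`). [folklore] -/
theorem Q_comp_dQ_add {x : N} (hx : x ∈ D.N₁) (v : TangentSpace (𝓡 4) x) :
    (D.QN x).comp (D.dQ x v) + (D.dQ x v).comp (D.QN x) = D.dQ x v := by
  set φ := extChartAt (𝓡 4) x with hφ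
  have hx0 : φ.symm (φ x) = x := extChartAt_to_inv x
  have hQ : HasFDerivAt (E := EuclideanSpace ℝ (Fin 4)) (D.QN ∘ φ.symm) (D.dQ x) (φ x) := hasFDerivAt_chart (D.mdifferentiableAt_QN hx)
  have hcomp := hQ.clm_comp hQ
  -- `Q ∘ Q = Q` pointwise
  have hidem : (fun q ↦ ((D.QN ∘ φ.symm) q).comp ((D.QN ∘ φ.symm) q)) = D.QN ∘ φ.symm := by
    funext q
    ext u
    exact D.Q_apply_eq_self_iff.2 (D.Q_apply_mem _ u)
  rw [hidem] at hcomp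
  have huniq := hcomp.unique hQ
  have happ := congrArg (fun L : EuclideanSpace ℝ (Fin 4) →L[ℝ] (V →L[ℝ] V) ↦ L v) huniq
  simp only [add_apply, ContinuousLinearMap.comp_apply,
    ContinuousLinearMap.compL_apply, ContinuousLinearMap.flip_apply, Function.comp_apply, hx0] at happ
  exact happ

/-- **`Q ((dQ v) n) = 0` for `n` in the normal plane.** [folklore] -/
theorem Q_dQ_apply_eq_zero {x : N} (hx : x ∈ D.N₁) (v : TangentSpace (𝓡 4) x) {n : V}
    (hn : n ∈ D.F (D.π₁ x)) : D.QN x (D.dQ x v n) = 0 := by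
  have h := congrArg (fun L : V →L[ℝ] V ↦ L n) (D.Q_comp_dQ_add hx v)
  simp only [add_apply, ContinuousLinearMap.comp_apply] at h
  have hQn : D.QN x n = n := D.Q_apply_eq_self_iff.2 hn
  rw [hQn] at h
  -- `Q (dQ n) + dQ n = dQ n`
  exact add_eq_right.1 h

/-- **`⟪(dJ v) n, J n⟫ = ⟪(dQ v) n, Q n⟫`** (differentiate `‖J n‖² = ‖Q n‖²`). [folklore] -/
theorem inner_dJ_J_eq {x : N} (hx : x ∈ D.N₁) (v : TangentSpace (𝓡 4) x) (n : V) :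
    ⟪D.dJ x v n, D.JN x n⟫ = ⟪D.dQ x v n, D.QN x n⟫ := by
  set φ := extChartAt (𝓡 4) x with hφ
  have hx0 : φ.symm (φ x) = x := extChartAt_to_inv x
  have hJ : HasFDerivAt (E := EuclideanSpace ℝ (Fin 4)) (D.JN ∘ φ.symm) (D.dJ x) (φ x) := hasFDerivAt_chart (D.mdifferentiableAt_JN hx)
  have hQ : HasFDerivAt (E := EuclideanSpace ℝ (Fin 4)) (D.QN ∘ φ.symm) (D.dQ x) (φ x) := hasFDerivAt_chart (D.mdifferentiableAt_QN hx)
  have hJn := (hJ.clm_apply (hasFDerivAt_const n (φ x))).norm_sq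
  have hQn := (hQ.clm_apply (hasFDerivAt_const n (φ x))).norm_sq
  -- the two functions agree: `‖J n‖² = ‖Q n‖²`
  have hfun : (‖(fun q ↦ ((D.JN ∘ φ.symm) q) n) ·‖ ^ 2) = (‖(fun q ↦ ((D.QN ∘ φ.symm) q) n) ·‖ ^ 2) := by
    funext q
    simp only [Function.comp_apply]
    rw [JN, QN, D.norm_J]
  rw [hfun] at hJn
  have huniq := hJn.unique hQn
  have happ := congrArg (fun L : EuclideanSpace ℝ (Fin 4) →L[ℝ] ℝ ↦ L v) huniq
  simp only [ContinuousLinearMap.comp_apply, add_apply, ContinuousLinearMap.flip_apply,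
    innerSL_apply_apply, Function.comp_apply, hx0, zero_apply, map_zero, zero_add, two_nsmul] at happ
  have h2' : (2 : ℝ) * ⟪D.JN x n, D.dJ x v n⟫ = 2 * ⟪D.QN x n, D.dQ x v n⟫ := by
    rw [two_mul, two_mul]; exact happ
  have h2 : ⟪D.JN x n, D.dJ x v n⟫ = ⟪D.QN x n, D.dQ x v n⟫ := mul_left_cancel₀ two_ne_zero h2'
  rw [real_inner_comm, h2, real_inner_comm]

/-- **`⟪(dJ v) n, J n⟫ = 0` for `n` in the normal plane.** [folklore] -/
theorem inner_dJ_J_eq_zero {x : N} (hx : x ∈ D.N₁) (v : TangentSpace (𝓡 4) x) {n : V}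
    (hn : n ∈ D.F (D.π₁ x)) : ⟪D.dJ x v n, D.JN x n⟫ = 0 := by
  rw [D.inner_dJ_J_eq hx v n]
  have hQn : D.QN x n = n := D.Q_apply_eq_self_iff.2 hn
  have hsa : ⟪D.dQ x v n, D.QN x n⟫ = ⟪D.QN x (D.dQ x v n), n⟫ := by
    rw [QN, D.Q_def, Submodule.inner_starProjection_left_eq_right]
  rw [hsa, D.Q_dQ_apply_eq_zero hx v hn, inner_zero_left]

/-! ### The moment map identity -/

/-- **`⟪(dΩ v) n, J n⟫ = dK v ‖n‖²`** for `n = nrm x`. [folklore] -/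
theorem inner_dOm_nrm_J {x : N} (hx : x ∈ D.N₁) (v : TangentSpace (𝓡 4) x) :
    ⟪D.dOm x v (D.nrm x), D.JN x (D.nrm x)⟫ = D.dK x v * ‖D.nrm x‖ ^ 2 := by
  rw [D.dOm_apply hx, add_apply, smul_apply, smul_apply, inner_add_left, real_inner_smul_left, real_inner_smul_left,
    D.inner_dJ_J_eq_zero hx v (D.nrm_mem_F x), mul_zero, add_zero, JN, D.inner_J_J, D.Q_nrm,
    real_inner_self_eq_norm_sq]

/-- **The moment map identity for the model form**: `s_M (Xm x, v) = -½ d(ρ2)ₓ v` on `N₃` —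
the model circle action is Hamiltonian for `s_M` with moment map `-½ K ‖nrm‖²`
(McLean 2012, proof of Lemma 5.17: `θ_P(X) = π r²`-type normalisation). [cite: Mclean2012, Lemma 5.17] -/
theorem sM_Xm [T2Space S] {x : N} (hx : x ∈ D.N₃) (v : TangentSpace (𝓡 4) x) :
    D.sM x ![D.Xm x, v] = -(1 / 2 : ℝ) * D.dρ2 x v := by
  have hx1 : x ∈ D.N₁ := D.N₃_subset_N₁ hx
  have hπ : D.dπ₁ x (D.Xm x) = 0 := D.dπ₁_Xm hx
  have hn : D.dnrm x (D.Xm x) = D.J (D.π₁ x) (D.nrm x) := D.dnrm_Xm hx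
  -- the retracted part vanishes on the vertical field
  have hB : D.sB x ![D.Xm x, v] = 0 := by
    rw [D.sB_apply, D.mfderiv_bπ₁_eq_zero_of_dπ₁ hx1 hπ]
    exact (D.s _).map_coord_zero (m := ![(0 : TangentSpace (𝓡 4) _), _]) 0 rfl
  rw [D.sM_apply, hB, zero_add, D.mextDeriv_lam0_apply hx1, hn, D.dOm_eq_zero_of_dπ₁ hx1 hπ,
    zero_apply, zero_add, D.dρ2_apply hx1]
  -- evaluate the inner products
  set n := D.nrm x with hn'
  set y := D.π₁ x with hy
  have hnF : n ∈ D.F y := D.nrm_mem_F x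
  have hQn : D.Q y n = n := D.Q_apply_eq_self_iff.2 hnF
  have h1 : ⟪D.Om y (D.J y n), D.dnrm x v⟫ = -(D.K y * ⟪n, D.dnrm x v⟫) := by
    rw [D.Om_apply, real_inner_smul_left, D.J_J_apply, hQn, inner_neg_left, mul_neg]
  have h2 : ⟪D.Om y (D.dnrm x v), D.J y n⟫ = D.K y * ⟪n, D.dnrm x v⟫ := by
    rw [D.Om_apply, real_inner_smul_left, D.inner_J_J, hQn]
    congr 1
    rw [D.Q_def, Submodule.inner_starProjection_left_eq_right, ← D.Q_def, hQn, real_inner_comm]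
  have h3 : ⟪D.dOm x v n, D.J y n⟫ = D.dK x v * ‖n‖ ^ 2 := D.inner_dOm_nrm_J hx1 v
  rw [inner_add_left, h1, h2, h3]
  show _ = -(1 / 2 : ℝ) * (D.dK x v * ‖n‖ ^ 2 + D.K y * (2 * ⟪n, D.dnrm x v⟫))
  ring

end Setup

end SurfaceTube

end Literature.Geometry.Symplectic
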